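import Summits.BirchSwinnertonDyer.Rank1Residual.P2.CongruentNumberPairsAtTwoPrimeSevenModEight
import Summits.BirchSwinnertonDyer.Rank1Residual.P2.CongruentNumberPairsAtTwoSelmerGenusBridge
import Literature.NumberTheory.EllipticCurves.Smith2016.CongruentNumberGenusDeterminantTwoPrimes
import Literature.NumberTheory.EllipticCurves.Smith2016.CongruentNumberGenusDeterminantRowsTwoThreeConsequences
import Literature.NumberTheory.EllipticCurves.CongruentNumberMonskySelmerParityBound
import Literature.NumberTheory.QuadraticFields.RedeiReichardtFourRank
import HarnessLib

/-!
# Cell `bsd-print-cf2`, prover p2 — the RANK-ZERO half of the `2`-descent-matrix road, as ONE displayed fact: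
# `BSD(E_n, 2)` for the congruent-number curves with `#Sel₂(E_n) = 4` and `Σ₁(n)` odd, from
# Tian–Yuan–Zhang 2017 Thm 1.1 ALONE (kernel `2`-descent; no Burungale–Flach, no Burungale–Tian, no GZK)

HONEST FRAMING (cell `bsd-print-cf2`, HOME `run/shared/lean/pub/bsd-print-cf2/`; PARTITION currency).
THIS FILE IS OFF-LEAF: the cell's leaf is `CornerF W 2 = HasCM ∧ analyticRank = 1` (row B14); the curves
here have analytic rank ZERO and sit in the COVERED row C8 (CM, `r = 0`, every prime — booked through
Burungale–Flach 2024, `bsdTriple_of_hasCM_of_L_one_ne_zero`, flag-free). It is the literal rank-zero content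
of prover p2's strategy sentence «2-descent matrix road: Heath-Brown / Monsky matrices give `#Sel₂` exactly
family-wide; + the 2-adic valuation of `L(E_n,1)/Ω` ⇒ r0 2-part of BSD family-wide», recorded as an
ALT-CLOSER on `C8 ∩ {j = 1728}` with a MINIMAL displayed set, and nothing more: "beyond-print theorem" —
NO (Smith 2016 Cor. 1.3 states it; Burungale–Flach 2024 proves the whole formula); census cells moved — `0`.

WHAT IT PROVES. For every square-free `n ≡ 1, 2, 3 (mod 8)` (root number `+1`) with
`#Sel⁽²⁾(E_n/ℚ) = 4` (Monsky's `s(n) = 0`; KERNEL-decidable for every `n` by the tree's Monsky matrices with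
equality, `HeathBrown1994.monsky_card_selmerGroup_two_{odd,even}_holds`) and Tian–Yuan–Zhang's first genus
sum `Σ₁(n) = Σ_{n = d₀⋯d_ℓ, dᵢ ≡ 1 (8) (i>0)} ∏ g(dᵢ)` ODD (decidable per `n` by Rédei matrices,
`redeiReichardt_fourTwoCard_classGroup_holds`): `ord_{s=1} L(E_n, s) = 0`, `rank E_n(ℚ) = 0`,
`Ш(E_n)[2^∞] = 0` and Miller's `BSD(E_n, 2)` — modulo the ONE displayed refereed fact
`h11 : TianYuanZhang2017.thm11_parity_of_scriptL` (Asian J. Math. 21 (2017) Thm 1.1: `𝓛(n) ∈ ℤ` and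
`𝓛(n) ≡ Σ₁(n) (mod 2)`). Route: `Σ₁` odd ⟹ `𝓛(n)` odd ⟹ `𝓛(n)² ≠ 0` ⟹ `r_an ≤ 1`, and `r_an` is even for
`n ≡ 1, 2, 3 (mod 8)` (tree theorem `even_analyticRank_congruentNumberCurve`, functional equation with sign
`+1`) ⟹ `r_an = 0` and `L(E_n, 1) = 2^{2k(n)−2−a(n)}·𝓛(n)²·Ω(E_n)` (`Ω(E_n) = Ω_{n,∞}`,
`realPeriodRat_congruentNumberCurve`); `#Sel₂ = 4` ⟹ rank `0`, `Ш[2^∞] = 0` (Silverman X.4.2 count, kernel);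
`Reg = 1`; `#E_n(ℚ)_tor = 4`, `∏ c_ℓ = 2^{2k(n)+2−a(n)}` (Tate's algorithm, kernel) ⟹ `#Ш_an = 𝓛(n)²` is a
`2`-adic unit `= #Ш[2^∞]`. By Smith 2016 Thm 2.2 (`Σ₁(n) ≡ det M (mod 2)`, tree-proved for one and two prime
factors, named fact `smith_thm22_rowOne` beyond) the two decidable hypotheses coincide; this file does not
use that. The existing rank-zero descent doors (`P2/CongruentNumberPairsAtTwoRankZero{Odd,Even}Descent.lean`)
display `{hBT (Burungale–Tian 2026), hH, hBF (Burungale–Flach 2024)}` instead; here the displayed set is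
`{h11}` — TYZ's Waldspurger/genus-period parity, the family-wide form of Zhao's 1997–2003 `2`-adic criteria.

* §1 two GZK-free bridges: the rank-`0` unfolding `L(E_n,1) = 2^{e}·𝓛²·Ω(E_n)` of `IsScriptL`, and Miller's
  `BSD(E, p)` ⟺ `ord_p x = ord_p ∏c_ℓ − 2·ord_p #E(ℚ)_tor` when `Ш[p^∞] = 0` and `L^{(r)}(E,1)/r! = x·Ω·Reg`
  (no finiteness of `Ш` needed: `BSD(E,p)` only speaks of `Ш[p^∞]`);
* §2 the door `rankZero_sha_bsdp_two_congruentNumberCurve_of_genusSum₁` (`{h11}` only);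
* §3 three uniform families with NO per-member input, all `{h11}` only: every prime `p ≡ 3 (mod 8)`; every
  `2p`, `p ≡ 5 (mod 8)`; every `p·q`, `p ≡ q ≡ 3 (mod 8)` (Genocchi's non-congruent numbers, with the `2`-part
  of their BSD formula).
Nothing booked; no mark moved; `0` census cells (row C8 is closed). Unit `bsd-print-cf2-p2` g0; NEW file.

References: [TianYuanZhang2017] Thm 1.1, §1 (𝓛(n), Ω_{n,∞}, (1.1)); [Smith2016CongruentDensity] Thm 1.2,
Cor 1.3, Thm 2.2; [HeathBrown1994SelmerCongruentII] §1, Appendix (Monsky); [Miller2011LMS] Def 1.1;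
[Feng1996NonCongruent] §1 (Genocchi); [BurungaleFlach2024] Thm 1.1 / Cor 2 (the print that books C8).
-/

noncomputable section

open scoped Classical

open Matrix Finset WeierstrassCurve NumberField Literature.NumberTheory.EllipticCurves
  Literature.NumberTheory.EllipticCurves.Rank1Residual
  Literature.NumberTheory.EllipticCurves.Rank1Residual.Typed
  Literature.NumberTheory.EllipticCurves.HeathBrown1994
  Literature.NumberTheory.EllipticCurves.TianYuanZhang2017
  Literature.NumberTheory.EllipticCurves.Smith2016
  Literature.NumberTheory.EllipticCurves.MonskySelmerParity
  Literature.NumberTheory.QuadraticFields.RedeiReichardt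

set_option autoImplicit false

namespace Summit.BirchSwinnertonDyer.Rank1Residual.P2

/-! ## §1 Two GZK-free bridges -/

section Bridges

/-- **Rank-zero unfolding of `𝓛(n)`**: if `ord_{s=1} L(E_n, s) = 0` and `L` is an integer with `L² = 𝓛(n)²`
(`IsScriptL n L`), then `L(E_n, 1) = leadingLCoeff = 2^{2k(n)−2−a(n)} · L² · Ω(E_n)` with the TREE's period
(`Ω(E_n) = Ω_{n,∞}`, `realPeriodRat_congruentNumberCurve`); no regulator appears in rank `0`.
[cite: TianYuanZhang2017, §1 (definition of 𝓛(n), p0002 L46–L75)] -/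
theorem leadingLCoeff_congruentNumberCurve_eq_of_isScriptL_of_analyticRank_eq_zero {n : ℕ} (hn : 0 < n)
    (hr : (congruentNumberCurve n).analyticRank = 0) {L : ℤ} (hL : IsScriptL n L) :
    (congruentNumberCurve n).leadingLCoeff =
      (2 : ℂ) ^ twoExponent n * (L : ℂ) ^ 2 * ((congruentNumberCurve n).realPeriodRat : ℂ) := by
  haveI := isElliptic_congruentNumberCurve hn.ne'
  have hΩ : (0 : ℝ) < (congruentNumberCurve n).realPeriodRat :=
    ((congruentNumberCurve n).baseChange ℝ).realPeriod_pos'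
  have hΩ' : (realPeriodTYZ n : ℂ) ≠ 0 := by
    rw [← realPeriodRat_congruentNumberCurve hn]; exact_mod_cast hΩ.ne'
  have h2 : (2 : ℂ) ^ twoExponent n ≠ 0 := zpow_ne_zero _ two_ne_zero
  have key : ((L : ℂ)) ^ 2 = (congruentNumberCurve n).leadingLCoeff /
      ((2 : ℂ) ^ twoExponent n * (realPeriodTYZ n : ℂ)) := by
    rw [hL]; unfold scriptLSq; rw [if_pos hr]
  rw [eq_div_iff (mul_ne_zero h2 hΩ')] at key
  rw [← realPeriodRat_congruentNumberCurve hn] at key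
  rw [← key]; ring

variable (V : WeierstrassCurve ℚ) [V.IsElliptic] (p : ℕ) [Fact p.Prime]

/-- **Miller's `BSD(E, p)` when `Ш(E)[p^∞] = 0`, GZK-free.** For an elliptic `V/ℚ` with
`rank E(ℚ) = r_an`, `Ш(E)[p^∞] = 0` and `L^{(r_an)}(E,1)/r_an! = x·Ω·Reg` (`x ∈ ℚ`, `x ≠ 0`): `BSD(E, p)` holds
iff `ord_p x = ord_p ∏ c_ℓ(E) − 2·ord_p #E(ℚ)_tor`. Unlike `bsdp_iff_valuation_of_leadingLCoeff` no finiteness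
of the whole of `Ш` is assumed — Miller's definition only involves the `p`-primary part.
[cite: Miller2011LMS, Def. 1.1 (arXiv:1010.2431 p. 3)] -/
theorem bsdp_iff_valuation_of_leadingLCoeff_of_primaryComponent_eq_bot
    (hrank : V.mordellWeilRank = V.analyticRank) {x : ℚ} (hx : x ≠ 0)
    (hL : V.leadingLCoeff = (x : ℂ) * (V.realPeriodRat : ℂ) * (V.regulator : ℂ))
    (hbot : AddCommGroup.primaryComponent V.sha p = ⊥) :
    BSDp V p ↔ padicValRat p x = (padicValNat p V.tamagawaProduct : ℤ) - 2 * padicValNat p V.torsionOrder := by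
  have hsha := shaAn_eq_of_leadingLCoeff V hL
  have ht : (V.torsionOrder : ℚ) ≠ 0 := by exact_mod_cast V.torsionOrder_pos_holds.ne'
  have hc : (V.tamagawaProduct : ℚ) ≠ 0 := by exact_mod_cast V.tamagawaProduct_pos_holds.ne'
  have hval : padicValRat p (x * (V.torsionOrder : ℚ) ^ 2 / (V.tamagawaProduct : ℚ)) =
      padicValRat p x + 2 * padicValNat p V.torsionOrder - padicValNat p V.tamagawaProduct := by
    rw [padicValRat.div (mul_ne_zero hx (pow_ne_zero 2 ht)) hc, padicValRat.mul hx (pow_ne_zero 2 ht),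
      padicValRat.pow (V.torsionOrder : ℚ), padicValRat.of_nat, padicValRat.of_nat]
    push_cast
    ring
  have hcard : Nat.card (AddCommGroup.primaryComponent V.sha p) = 1 := by
    rw [hbot]; exact Nat.card_unique
  have hfin : Finite (AddCommGroup.primaryComponent V.sha p) := by
    rw [hbot]; infer_instance
  constructor
  · rintro ⟨-, -, q, hq, hv⟩
    have hqx : q = x * (V.torsionOrder : ℚ) ^ 2 / (V.tamagawaProduct : ℚ) := by
      exact_mod_cast hq.symm.trans hsha
    subst hqx
    rw [hval, hcard] at hv
    simp only [padicValNat_one_right, Nat.cast_zero] at hv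
    linarith
  · intro hv
    refine ⟨hrank, hfin, _, hsha, ?_⟩
    rw [hval, hcard, hv]
    simp

end Bridges

/-! ## §2 The rank-zero door, displayed set `{h11}` -/

section Door

/-- **THE RANK-ZERO `2`-DESCENT DOOR FROM TYZ Thm 1.1 ALONE.** For square-free `n ≡ 1, 2, 3 (mod 8)` with
`#Sel⁽²⁾(E_n/ℚ) = 4` and `Σ₁(n)` odd (over `GenusField`): `ord_{s=1} L(E_n, s) = 0`, `rank E_n(ℚ) = 0`,
`Ш(E_n)[2^∞] = 0` and `BSD(E_n, 2)` — modulo `h11` ONLY. (Row C8 companion; off the cell's leaf.)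
[cite: TianYuanZhang2017, Thm. 1.1 and §1 (1.1)] [cite: Smith2016CongruentDensity, Thm. 1.2 and Cor. 1.3]
[cite: SilvermanAEC2009, Thm. X.4.2] [cite: Miller2011LMS, Def. 1.1 (arXiv:1010.2431 p. 3)] -/
theorem rankZero_sha_bsdp_two_congruentNumberCurve_of_genusSum₁ (h11 : thm11_parity_of_scriptL)
    {n : ℕ} (hsq : Squarefree n) (h8 : n % 8 = 1 ∨ n % 8 = 2 ∨ n % 8 = 3)
    (hsel : Nat.card ((congruentNumberCurve n).selmerGroup 2) = 4)
    (hgen : Odd (genusSum₁ n fun d => genusClassNumber (GenusField d))) :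
    haveI := isElliptic_congruentNumberCurve hsq.ne_zero
    (congruentNumberCurve n).analyticRank = 0 ∧ (congruentNumberCurve n).mordellWeilRank = 0 ∧
      AddCommGroup.primaryComponent (congruentNumberCurve n).sha 2 = ⊥ ∧
      BSDp (congruentNumberCurve n) 2 := by
  have hn0 : n ≠ 0 := hsq.ne_zero
  haveI := isElliptic_congruentNumberCurve hn0
  haveI : Fact (Nat.Prime 2) := ⟨Nat.prime_two⟩
  -- TYZ Thm 1.1: `𝓛(n)` is an odd integer
  obtain ⟨L, hL, hpar⟩ := h11 n hsq h8 GenusField (isGenusFieldFamily_genusField n)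
  have hLodd : Odd L := (intCast_zmod_two_eq_one_iff_odd L).mp
    (by rw [hpar]; exact ZMod.natCast_eq_one_iff_odd.mpr hgen)
  have hL0 : L ≠ 0 := fun h => by simp [h] at hLodd
  -- hence `r_an ≤ 1`, and `r_an` is even: `r_an = 0`
  have hr : (congruentNumberCurve n).analyticRank = 0 := by
    by_contra h0
    by_cases h1 : (congruentNumberCurve n).analyticRank = 1
    · have heven := even_analyticRank_congruentNumberCurve hsq h8
      rw [h1] at heven
      exact Nat.not_even_one heven
    · have hsq0 : scriptLSq n = 0 := by
        unfold scriptLSq; rw [if_neg h0, if_neg h1]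
      have : ((L : ℂ)) ^ 2 = 0 := by rw [hL, hsq0]
      exact hL0 (by exact_mod_cast pow_eq_zero_iff (n := 2) (by norm_num) |>.mp this)
  -- kernel `2`-descent: rank `0`, `Ш[2^∞] = 0`
  obtain ⟨hrank, hbot⟩ := (card_selmerGroup_two_eq_four_iff_rank_zero_and_sha hn0).mp hsel
  refine ⟨hr, hrank, hbot, ?_⟩
  -- `L(E_n,1) = 2^e · L² · Ω · Reg` (`Reg = 1`)
  have hlead : (congruentNumberCurve n).leadingLCoeff =
      (((2 : ℚ) ^ twoExponent n * (L : ℚ) ^ 2 : ℚ) : ℂ) *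
        ((congruentNumberCurve n).realPeriodRat : ℂ) * ((congruentNumberCurve n).regulator : ℂ) := by
    rw [leadingLCoeff_congruentNumberCurve_eq_of_isScriptL_of_analyticRank_eq_zero
      (Nat.pos_of_ne_zero hn0) hr hL, regulator_eq_one_of_rank_zero (congruentNumberCurve n) hrank]
    push_cast; ring
  have hx0 : (2 : ℚ) ^ twoExponent n * (L : ℚ) ^ 2 ≠ 0 := by
    have hL0' : (L : ℚ) ≠ 0 := by exact_mod_cast hL0
    exact mul_ne_zero (zpow_ne_zero _ two_ne_zero) (pow_ne_zero _ hL0')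
  rw [bsdp_iff_valuation_of_leadingLCoeff_of_primaryComponent_eq_bot (congruentNumberCurve n) 2
    (hrank.trans hr.symm) hx0 hlead hbot, padicValRat_two_zpow_mul_sq hLodd,
    tamagawaProduct_congruentNumberCurve_eq_two_pow hsq, torsionOrder_congruentNumberCurve hsq,
    padicValNat.prime_pow, show (4 : ℕ) = 2 ^ 2 by norm_num, padicValNat.prime_pow]
  unfold twoExponent oddPrimeFactorCount oddIndicator
  split_ifs <;> push_cast <;> omega

/-- **`BSD(E_n, 2)` in rank zero from `{h11}` only** (closed form of the door).
[cite: TianYuanZhang2017, Thm. 1.1 and §1 (1.1)] [cite: Miller2011LMS, Def. 1.1 (arXiv:1010.2431 p. 3)] -/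
theorem bsdp_two_congruentNumberCurve_of_genusSum₁ (h11 : thm11_parity_of_scriptL)
    {n : ℕ} (hsq : Squarefree n) (h8 : n % 8 = 1 ∨ n % 8 = 2 ∨ n % 8 = 3)
    (hsel : Nat.card ((congruentNumberCurve n).selmerGroup 2) = 4)
    (hgen : Odd (genusSum₁ n fun d => genusClassNumber (GenusField d))) :
    BSDp (congruentNumberCurve n) 2 :=
  (rankZero_sha_bsdp_two_congruentNumberCurve_of_genusSum₁ h11 hsq h8 hsel hgen).2.2.2

end Door

/-! ## §3 Three uniform rank-zero families from `{h11}` only -/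

section Families

/-- **Every prime `p ≡ 3 (mod 8)`**: `ord_{s=1} L(E_p, s) = 0`, rank `0`, `Ш(E_p)[2^∞] = 0`, `BSD(E_p, 2)` —
modulo `h11` only. Kernel inputs: `#Sel₂(E_p) = 4` (Monsky's one-prime table), `Σ₁(p) = g(p)` odd
(Rédei–Reichardt at `t = 1`). [cite: TianYuanZhang2017, Thm. 1.1] [cite: HeathBrown1994SelmerCongruentII, §1 typescript p. 6 (one-prime Selmer ranks)]
[cite: Miller2011LMS, Def. 1.1 (arXiv:1010.2431 p. 3)] -/
theorem rankZero_sha_bsdp_two_congruentNumberCurve_prime_three_mod_eight (h11 : thm11_parity_of_scriptL)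
    {p : ℕ} (hp : p.Prime) (h8 : p % 8 = 3) :
    haveI := isElliptic_congruentNumberCurve hp.ne_zero
    (congruentNumberCurve p).analyticRank = 0 ∧ (congruentNumberCurve p).mordellWeilRank = 0 ∧
      AddCommGroup.primaryComponent (congruentNumberCurve p).sha 2 = ⊥ ∧
      BSDp (congruentNumberCurve p) 2 := by
  have hsel : Nat.card ((congruentNumberCurve p).selmerGroup 2) = 4 := by
    rw [card_selmerGroup_two_congruentNumberCurve_prime hp (by omega), if_neg (by omega), if_pos h8]
  exact rankZero_sha_bsdp_two_congruentNumberCurve_of_genusSum₁ h11 hp.squarefree (Or.inr (Or.inr h8))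
    hsel (odd_genusSum₁_genusField_prime redeiReichardt_fourTwoCard_classGroup_holds hp (by omega))

/-- **`BSD(E_p, 2)` for EVERY prime `p ≡ 3 (mod 8)`**, modulo `h11` only.
[cite: TianYuanZhang2017, Thm. 1.1] [cite: Miller2011LMS, Def. 1.1 (arXiv:1010.2431 p. 3)] -/
theorem forall_bsdp_two_congruentNumberCurve_prime_three_mod_eight (h11 : thm11_parity_of_scriptL) :
    ∀ p : ℕ, p.Prime → p % 8 = 3 → BSDp (congruentNumberCurve p) 2 :=
  fun _ hp h8 => (rankZero_sha_bsdp_two_congruentNumberCurve_prime_three_mod_eight h11 hp h8).2.2.2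

/-- **Every `2p`, `p ≡ 5 (mod 8)` prime**: `ord_{s=1} L(E_{2p}, s) = 0`, rank `0`, `Ш(E_{2p})[2^∞] = 0`,
`BSD(E_{2p}, 2)` — modulo `h11` only. Kernel inputs: `#Sel₂(E_{2p}) = 4` (Monsky's even one-prime table),
`Σ₁(2p) ≡ det M = 1` (Smith's Thm 2.2 row `2` at one prime factor, tree-proved).
[cite: TianYuanZhang2017, Thm. 1.1] [cite: Smith2016CongruentDensity, Thm. 2.2 row 2]
[cite: HeathBrown1994SelmerCongruentII, §1 typescript p. 6 L26–L28] [cite: Miller2011LMS, Def. 1.1 (arXiv:1010.2431 p. 3)] -/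
theorem rankZero_sha_bsdp_two_congruentNumberCurve_two_mul_prime_five_mod_eight
    (h11 : thm11_parity_of_scriptL) {p : ℕ} (hp : p.Prime) (h8 : p % 8 = 5) :
    haveI := isElliptic_congruentNumberCurve (mul_ne_zero two_ne_zero hp.ne_zero)
    (congruentNumberCurve (2 * p)).analyticRank = 0 ∧ (congruentNumberCurve (2 * p)).mordellWeilRank = 0 ∧
      AddCommGroup.primaryComponent (congruentNumberCurve (2 * p)).sha 2 = ⊥ ∧
      BSDp (congruentNumberCurve (2 * p)) 2 := by
  have hp2 : p ≠ 2 := by omega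
  have hsq : Squarefree (2 * p) := by
    rw [Nat.squarefree_mul ((Nat.coprime_primes Nat.prime_two hp).mpr hp2.symm)]
    exact ⟨Nat.prime_two.squarefree, hp.squarefree⟩
  have hsel : Nat.card ((congruentNumberCurve (2 * p)).selmerGroup 2) = 4 := by
    rw [card_selmerGroup_two_congruentNumberCurve_two_mul_prime hp hp2, if_neg (by omega), if_pos h8]
  have hdet : (monskyMatrixEven ![p]).det = 1 :=
    (monskySelmerRankEven_eq_zero_iff_det ![p]).mp
      (by rw [monskySelmerRankEven_prime hp hp2, if_neg (by omega), if_pos h8])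
  have hgen : Odd (genusSum₁ (2 * p) fun d => genusClassNumber (GenusField d)) := by
    rw [← ZMod.natCast_eq_one_iff_odd, smith_thm22_rowTwo_prime hp (by omega), hdet]
  exact rankZero_sha_bsdp_two_congruentNumberCurve_of_genusSum₁ h11 hsq (Or.inr (Or.inl (by omega)))
    hsel hgen

/-- **`BSD(E_{2p}, 2)` for EVERY prime `p ≡ 5 (mod 8)`**, modulo `h11` only.
[cite: TianYuanZhang2017, Thm. 1.1] [cite: Miller2011LMS, Def. 1.1 (arXiv:1010.2431 p. 3)] -/
theorem forall_bsdp_two_congruentNumberCurve_two_mul_prime_five_mod_eight (h11 : thm11_parity_of_scriptL) :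
    ∀ p : ℕ, p.Prime → p % 8 = 5 → BSDp (congruentNumberCurve (2 * p)) 2 :=
  fun _ hp h8 => (rankZero_sha_bsdp_two_congruentNumberCurve_two_mul_prime_five_mod_eight h11 hp h8).2.2.2

/-- **Every `p·q`, `p ≡ q ≡ 3 (mod 8)` distinct primes (Genocchi, 1855)**: `ord_{s=1} L(E_{pq}, s) = 0`,
rank `0`, `Ш(E_{pq})[2^∞] = 0`, `BSD(E_{pq}, 2)` — modulo `h11` only. Kernel inputs: the tree's unconditional
`rank E_{pq} = 0 ∧ Ш[2^∞] = 0 ⟺ p ≡ 3 (mod 8) ⟺ Σ₁(pq)` odd (Smith's Thm 2.2 row `1` at two prime factors).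
[cite: TianYuanZhang2017, Thm. 1.1] [cite: Smith2016CongruentDensity, Thm. 2.2 row 1]
[cite: Feng1996NonCongruent, §1 p. 72 (Genocchi: p₃q₃)] [cite: Miller2011LMS, Def. 1.1 (arXiv:1010.2431 p. 3)] -/
theorem rankZero_sha_bsdp_two_congruentNumberCurve_three_three (h11 : thm11_parity_of_scriptL)
    {p q : ℕ} (hp : p.Prime) (hq : q.Prime) (hne : p ≠ q) (hp3 : p % 8 = 3) (hq3 : q % 8 = 3) :
    haveI := isElliptic_congruentNumberCurve (mul_ne_zero hp.ne_zero hq.ne_zero)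
    (congruentNumberCurve (p * q)).analyticRank = 0 ∧ (congruentNumberCurve (p * q)).mordellWeilRank = 0 ∧
      AddCommGroup.primaryComponent (congruentNumberCurve (p * q)).sha 2 = ⊥ ∧
      BSDp (congruentNumberCurve (p * q)) 2 := by
  have hp2 : p ≠ 2 := by omega
  have hq2 : q ≠ 2 := by omega
  have hr : p % 8 = q % 8 := by rw [hp3, hq3]
  have hsq : Squarefree (p * q) := by
    rw [Nat.squarefree_mul ((Nat.coprime_primes hp hq).mpr hne)]
    exact ⟨hp.squarefree, hq.squarefree⟩
  have hrs := (rank_zero_and_sha_pair_iff_three_mod_eight hp hq hne hp2 hq2 hr).mpr hp3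
  have hsel : Nat.card ((congruentNumberCurve (p * q)).selmerGroup 2) = 4 :=
    (card_selmerGroup_two_eq_four_iff_rank_zero_and_sha (mul_ne_zero hp.ne_zero hq.ne_zero)).mpr hrs
  have hgen : Odd (genusSum₁ (p * q) fun d => genusClassNumber (GenusField d)) :=
    (rank_zero_and_sha_pair_iff_odd_genusSum₁ hp hq hne hp2 hq2 hr).mp hrs
  have h8 : (p * q) % 8 = 1 := by rw [Nat.mul_mod, hp3, hq3]
  exact rankZero_sha_bsdp_two_congruentNumberCurve_of_genusSum₁ h11 hsq (Or.inl h8) hsel hgen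

/-- **`BSD(E_{pq}, 2)` for ALL distinct primes `p ≡ q ≡ 3 (mod 8)`**, modulo `h11` only.
[cite: TianYuanZhang2017, Thm. 1.1] [cite: Feng1996NonCongruent, §1 p. 72 (Genocchi)]
[cite: Miller2011LMS, Def. 1.1 (arXiv:1010.2431 p. 3)] -/
theorem forall_bsdp_two_congruentNumberCurve_three_three (h11 : thm11_parity_of_scriptL) :
    ∀ p q : ℕ, p.Prime → q.Prime → p ≠ q → p % 8 = 3 → q % 8 = 3 → BSDp (congruentNumberCurve (p * q)) 2 :=
  fun _ _ hp hq hne hp3 hq3 =>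
    (rankZero_sha_bsdp_two_congruentNumberCurve_three_three h11 hp hq hne hp3 hq3).2.2.2

end Families

end Summit.BirchSwinnertonDyer.Rank1Residual.P2

end
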